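import Mathlib
import HarnessLib

/-!
# The Schönhage–Strassen cost recurrence: `T(k) ≤ 2^{⌈k/2⌉} T(⌊k/2⌋+1) + B·2^k·k` gives `n log² n`

Topic `Computability/AlgebraicComplexity`, companion of `SchonhageStrassenRecursion.lean`
(Algorithm 8.20 of von zur Gathen–Gerhard, *Modern Computer Algebra*, as the recursive function
`negMul`, and its correctness).  The operation count of Algorithm 8.20 (GG Thm 8.22, proof)
satisfies `T(k) ≤ 2^{⌈k/2⌉} T(⌊k/2⌋ + 1) + 9·2^k(⌈k/2⌉ + 1)` for `k > 2`, which the source solves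
to `9/2 · n log n log log n + O(n log n)` (`n = 2^k`).  Any machine realisation obeys a
recurrence of the same shape with its own constants (and further `polylog` factors from the
coefficient arithmetic).  This file solves the recurrence once, in the generality needed by
both, to the weaker but sufficient bound `O(n log² n)`:

* **`schonhage_recurrence_le`**: if `u k ≤ A` for `k ≤ 2` and
  `u k ≤ 2^{k-⌊k/2⌋} u (⌊k/2⌋+1) + B·2^k·k` for `k ≥ 3`, then `u k ≤ (A+B)·2^k·(k+1)²` for all
  `k` (note `k − ⌊k/2⌋ = ⌈k/2⌉` and `⌈k/2⌉ + 1 ≤ k` for `k ≥ 2`, so GG's recurrence is the case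
  `B = 9`).  Proof: strong induction; `k ≤ 6` by unrolling, `k ≥ 7` by
  `2(⌊k/2⌋+2)² + k ≤ (k+1)²`.

## References

* J. von zur Gathen, J. Gerhard, *Modern Computer Algebra*, CUP (1st ed. 1999, 3rd ed. 2013),
  §8.3, proof of Theorem 8.22 (the recurrence for `T(k)`; text checked on the internal scan
  panama:448136887664644). [GathenGerhard2013]
-/

namespace Literature.Computability.AlgebraicComplexity

/-- The key inequality of the inductive step, even case: `2(q+2)² + 2q ≤ (2q+1)²` for `q ≥ 4`.
[folklore] -/
theorem two_mul_sq_add_le_sq_even {q : ℕ} (hq : 4 ≤ q) :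
    2 * (q + 2) ^ 2 + 2 * q ≤ (2 * q + 1) ^ 2 := by
  nlinarith [hq]

/-- The key inequality of the inductive step, odd case: `2(q+2)² + (2q+1) ≤ (2q+2)²` for
`q ≥ 3`. [folklore] -/
theorem two_mul_sq_add_le_sq_odd {q : ℕ} (hq : 3 ≤ q) :
    2 * (q + 2) ^ 2 + (2 * q + 1) ≤ (2 * q + 2) ^ 2 := by
  nlinarith [hq]

/-- **The Schönhage–Strassen recurrence solved to `O(n log² n)`** (cf. GG Thm 8.22, proof, where
the sharper `O(n log n log log n)` is derived): if `u k ≤ A` for `k ≤ 2` and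
`u k ≤ 2^{k−⌊k/2⌋} · u(⌊k/2⌋+1) + B · 2^k · k` for `k ≥ 3`, then
`u k ≤ (A + B) · 2^k · (k+1)²` for every `k`. [cite: GathenGerhard2013, §8.3 Thm 8.22 (proof, recurrence for T(k))] -/
theorem schonhage_recurrence_le {u : ℕ → ℕ} {A B : ℕ} (hbase : ∀ k ≤ 2, u k ≤ A)
    (hstep : ∀ k, 3 ≤ k → u k ≤ 2 ^ (k - k / 2) * u (k / 2 + 1) + B * 2 ^ k * k) :
    ∀ k, u k ≤ (A + B) * 2 ^ k * (k + 1) ^ 2 := by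
  intro k
  induction k using Nat.strong_induction_on with
  | _ k ih =>
  rcases Nat.lt_or_ge 2 k with hk2 | hk2
  swap
  · -- base
    have h1 : 1 ≤ 2 ^ k * (k + 1) ^ 2 := Nat.one_le_iff_ne_zero.2 (by positivity)
    calc u k ≤ A := hbase k hk2
      _ ≤ (A + B) * 1 := by omega
      _ ≤ (A + B) * (2 ^ k * (k + 1) ^ 2) := Nat.mul_le_mul_left _ h1
      _ = (A + B) * 2 ^ k * (k + 1) ^ 2 := by ring
  rcases Nat.lt_or_ge 6 k with hk7 | hk6
  swap
  · -- small cases by unrolling the recurrence down to `u 2 ≤ A`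
    have h2 := hbase 2 le_rfl
    have h3 := hstep 3 (by norm_num)
    have h4 := hstep 4 (by norm_num)
    have h5 := hstep 5 (by norm_num)
    have h6 := hstep 6 (by norm_num)
    norm_num at h3 h4 h5 h6
    interval_cases k <;> norm_num <;> omega
  -- inductive step, `k ≥ 7`
  set q := k / 2 with hq
  have hqk : q + 1 < k := by omega
  have hih := ih (q + 1) hqk
  have hpow : 2 ^ (k - q) * 2 ^ (q + 1) = 2 * 2 ^ k := by
    rw [← pow_add, show k - q + (q + 1) = k + 1 by omega, pow_succ, mul_comm]
  have hBM : B ≤ A + B := Nat.le_add_left B A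
  -- `u k ≤ 2^k · (2 (A+B) (q+2)² + B k)`
  have h1 : u k ≤ 2 ^ k * (2 * (A + B) * (q + 2) ^ 2 + B * k) := by
    calc u k ≤ 2 ^ (k - q) * u (q + 1) + B * 2 ^ k * k := hstep k (by omega)
      _ ≤ 2 ^ (k - q) * ((A + B) * 2 ^ (q + 1) * (q + 1 + 1) ^ 2) + B * 2 ^ k * k :=
          Nat.add_le_add_right (Nat.mul_le_mul_left _ hih) _
      _ = 2 ^ (k - q) * 2 ^ (q + 1) * ((A + B) * (q + 2) ^ 2) + B * 2 ^ k * k := by ring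
      _ = 2 ^ k * (2 * (A + B) * (q + 2) ^ 2 + B * k) := by rw [hpow]; ring
  refine h1.trans ?_
  rw [show (A + B) * 2 ^ k * (k + 1) ^ 2 = 2 ^ k * ((A + B) * (k + 1) ^ 2) by ring]
  refine Nat.mul_le_mul_left _ ?_
  -- `2 (A+B) (q+2)² + B k ≤ (A+B) (2 (q+2)² + k) ≤ (A+B) (k+1)²`
  calc 2 * (A + B) * (q + 2) ^ 2 + B * k
      ≤ 2 * (A + B) * (q + 2) ^ 2 + (A + B) * k :=
        Nat.add_le_add_left (Nat.mul_le_mul_right _ hBM) _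
    _ = (A + B) * (2 * (q + 2) ^ 2 + k) := by ring
    _ ≤ (A + B) * (k + 1) ^ 2 := Nat.mul_le_mul_left _ ?_
  rcases Nat.even_or_odd k with ⟨r, hr⟩ | ⟨r, hr⟩
  · have hrq : q = r := by omega
    subst hrq
    rw [show k = 2 * q by omega]
    exact two_mul_sq_add_le_sq_even (by omega)
  · have hrq : q = r := by omega
    subst hrq
    rw [hr]
    exact two_mul_sq_add_le_sq_odd (by omega)

end Literature.Computability.AlgebraicComplexity
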